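import Summits.BirchSwinnertonDyer.BirchSwinnertonDyer.Theorems.EisensteinPrimesAcTwistDeformationImprimCorank
import Summits.BirchSwinnertonDyer.BirchSwinnertonDyer.Theorems.EisensteinPrimesStrictEqUnramifiedDualTransfer
import Summits.BirchSwinnertonDyer.BirchSwinnertonDyer.Theorems.EisensteinPrimesGrSelmerImprimitiveLambdaShift
import Summits.BirchSwinnertonDyer.BirchSwinnertonDyer.Theorems.EisensteinPrimesRamifiedCharNoLocalFixed
import Literature.NumberTheory.EllipticCurves.CastellaGrossiLeeSkinner2022.CharacterGreenbergSelmerLambdaRelaxation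
import Literature.NumberTheory.EllipticCurves.CastellaGrossiLeeSkinner2022.CharacterGreenbergSelmerDual
import HarnessLib

/-!
# CGLS 2022 Prop. 1.2.5's corank clause (eq:sur2) ∘ Lemma 1.1.1 — the named fact
# `prop125_characterGrSelmerDual_corank_ge` — IS A THEOREM modulo Greenberg 2016 Prop. 2.6.3, Greenberg 2006
# Props. 4.1 / 4.2 / §5 A / 3.2 and CGLS Prop. 1.2.5's module clause, all BY NAME
# (cell `bsd-eis`, width seat `bsd-line-x2-p2` gen 9; crux 4 `BSDpOnCellC` stmt-BirchSwinnertonDyer-19034, line b1 v12 —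
# skeleton of record 155e218d… UNCHANGED, W-79)

WHY. Seat g8 typed the `≥` half of the STRICT `S`-relaxation corank identity at CHARACTER level as ONE published named
fact `CastellaGrossiLeeSkinner2022.prop125_characterGrSelmerDual_corank_ge` (p657936; CGLS Prop. 1.2.5's proof: the
surjectivity (eq:sur2) = Pollack–Weston 2011 Prop. A.2, read in `ℤ_p`-coranks with Lemma 1.1.1) and keyed the whole
non-split chain of the wall `stub_imprimitiveCount` on it (p658583, p659330, p659748, p661876, p662145). This file
DISCHARGES it from facts the cell's chains already carry: the x1 cell's road (A) (LEAD g2,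
`AcTwistDeformation.exists_mem_unrSelmer_forall_resOfLe_conjH1_eq`: the `K_∞`-side global-to-local surjectivity for the
one-variable twist deformation `𝐃₁(θ)` from Greenberg 2016 Prop. 2.6.3 + Greenberg 2006 Props. 4.1/4.2/§5A/3.2) is
GENERIC in the character; only its residual-pair instantiation (`…ImprimCorank`, GOOD lattice, `𝓕_nr`) was written. Here
it is instantiated at CGLS's character-level binders and carried to the STRICT currency:

* §1 bookkeeping at CGLS's binders: a place over a rational prime SPLIT in `K` is finitely decomposed in the
  anticyclotomic tower (Brink 2007 Thm. 2, `ZpExtension.decomp_not_le_kerSubgroup_of_isAnticyclotomic_holds`); a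
  Teichmüller character whose RESIDUAL character is unramified at `w` is unramified at `w` (`θ(σ) ≠ 1 ⇒ σ` fixes no
  non-zero point of `(F/𝒪)(θ)`, `CharResidualSelmerCount.charModule_eq_zero_of_smul_eq`), whence
  `N_Σ ≤ ker (unitChar θ)` for `Σ = {v, v̄} ∪ S` (one prime above `w` suffices: `I_{τ•𝔓} = τ I_𝔓 τ⁻¹`);
* §2 [RH] for the model: CGLS Prop. 1.2.5's module clause (`𝔛_θ^S` f.g. torsion, `μ = 0`; named fact
  `prop125_characterGrSelmerDual_torsion_muZero_dim`, PUB) ⟹ the primitive strict dual is f.g. torsion (g8's strict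
  λ-shift `GrSelmerImprimitiveLambdaShift`, kernel) ⟹ so is the primitive UNRAMIFIED dual (g8's bridge
  `grSelmer_charModule_eq_unrSelmer`, UNCONDITIONAL for `θ|_{G_v̄} ≠ 𝟙`, + transfer `prop_datumDualData_of_forall_grDualData`)
  ⟹ `corank_Λ S_{𝓛_v}(K, 𝐃₁(θ)) = 0` (LEAD g2's `hasCorank_fullAtSelmer_zero_of_datumDualData`);
* §3 the theorem: road (A)'s surjectivity + the x1 width seats' corank bookkeeping
  (`UnrSelmerLocSurjAdapter.sum_charLocalLambda_le_zpCorank_unrSelmer_quotient_of_forall_exists`) give the `𝓕_nr`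
  inequality, and the bridge at `S` and at `∅` turns it into the `𝓕_Gr` inequality — `prop125_characterGrSelmerDual_corank_ge`
  TOKEN FOR TOKEN.

WHAT IT BUYS. The named-fact debt g8 opened (+1) is closed (−1): every consumer of `hge : prop125_characterGrSelmerDual_corank_ge`
(p658583 §1, p659748 §3–§4, p661876, p659330, p662145) can be fed `prop125_characterGrSelmerDual_corank_ge_of_facts h263 h41 h42
h5A h32 hprop125`, whose six hypotheses are PUBLISHED statements already among the hypotheses of the cell's crux-2 / crux-4
chains (Greenberg 2016 Prop. 2.6.3; Greenberg 2006 Props. 4.1, 4.2, §5 A, 3.2; CGLS Prop. 1.2.5 module clause).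

HONEST FRAMING: theorems only (no `def`, no new named fact, no `sorry`); CONDITIONAL on the six published facts it
names and on nothing else; closes no stub; skeleton of record unchanged (W-79); no summit statement, no case of BSD /
Mazur's main conjecture / IMC is proved; 0 cells / labels / tiers move.

References: [CastellaGrossiLeeSkinner2022] §1.1 Lemma 1.1.1, §1.2 Def. 1.2.1, Thm. 1.2.2, Prop. 1.2.5 and proof
(eq:sur1)–(eq:sur2) (arXiv:2008.02571 Lemma 9, Thm. 11, Prop. 14; Invent. Math. 227 (2022) 517–580);
[PollackWeston2011] App. A Prop. A.2; [Greenberg2016Selmer] Prop. 2.6.3; [Greenberg2006] Props. 3.2, 4.1, 4.2, §5 A;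
[Brink2007] Thm. 2, Cor. 1; [KellerYin2024] Prop. 1.2.5, Rem. 1.2.3, Lemma 1.2.4 (arXiv:2402.12781v2; the 𝓕_nr twins);
[GreenbergVatsal2000] §2 Cor. (2.3), Prop. (2.4); [NeukirchANT1999] Ch. I §8–§9, Ch. II §9 Prop. (9.6);
[SerreLocalFields1979] IV §2.
-/

set_option autoImplicit false
set_option linter.dupNamespace false -- the summit namespace `…BirchSwinnertonDyer.BirchSwinnertonDyer.Theorems` (Sub = Summit, D-0017) trips it

noncomputable section

open scoped Classical AddSubgroup
open NumberField IsDedekindDomain Field Multiplicative PowerSeries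
open Literature.NumberTheory.EllipticCurves Literature.NumberTheory.EllipticCurves.GreenbergSelmer
  Literature.NumberTheory.EllipticCurves.GreenbergVatsal2000 Literature.NumberTheory.GaloisRepresentations
  Literature.NumberTheory.EllipticCurves.KellerYin2024 Literature.NumberTheory.EllipticCurves.IwasawaDual
  Literature.NumberTheory.EllipticCurves.CastellaGrossiLeeSkinner2022
  Literature.NumberTheory.IwasawaTheory Literature.NumberTheory.IwasawaTheory.Greenberg2016
  Literature.NumberTheory.IwasawaTheory.Greenberg2006
  Summit.BirchSwinnertonDyer.BirchSwinnertonDyer.Theorems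
  Summit.BirchSwinnertonDyer.BirchSwinnertonDyer.Theorems.AcTwistDeformation
  Summit.BirchSwinnertonDyer.BirchSwinnertonDyer.Theorems.AcTwistDeformationResidualPair

namespace Summit.BirchSwinnertonDyer.BirchSwinnertonDyer.Theorems.CharGrSelmerCorankGeOfFacts

variable {K : Type} [Field K] [NumberField K] {p : ℕ} [hp : Fact p.Prime]

/-! ## §1 Bookkeeping at CGLS's character-level binders -/

/-- **A place of the imaginary quadratic `K` over a rational prime SPLIT in `K` (CGLS: «conductor only divisible by primes
split in `K`», typed `((w ∩ ℤ)).primesOver (𝓞 K)).ncard = 2`) and prime to the odd `p` is FINITELY DECOMPOSED in the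
anticyclotomic `ℤ_p`-tower**: `D_w ⊄ ker κ`, i.e. some `δ ∈ D_w` has `κ δ ≠ 1` — Brink 2007 Thm. 2 (tree theorem
`ZpExtension.decomp_not_le_kerSubgroup_of_isAnticyclotomic_holds`) at a degree-one place
(`ℓ = N(w ∩ ℤ)`, Mathlib `Nat.absNorm_under_prime`; `ramificationIdx_eq_one_and_inertiaDeg_eq_one_of_ncard_primesOver_eq_two`).
Pollack–Weston's hypothesis (1) of Prop. A.2.
[cite: Brink2007, Thm. 2 (pp. 2134–2135) and Cor. 1 (p. 2136)] [cite: PollackWeston2011, App. A Prop. A.2 (1)]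
[cite: CastellaGrossiLeeSkinner2022, §1.2 (standing hypothesis on the conductor of θ; arXiv:2008.02571)] -/
theorem exists_mem_decomp_apply_ne_one_of_ncard_primesOver_under (hK : IsImaginaryQuadratic K) (hp2 : p ≠ 2)
    (κ : ZpExtension K p) (hκ : κ.IsAnticyclotomic) (w : HeightOneSpectrum (𝓞 K))
    (hpw : ((p : ℕ) : 𝓞 K) ∉ w.asIdeal) (hsplit : ((w.asIdeal.under ℤ).primesOver (𝓞 K)).ncard = 2) :
    ∃ δ ∈ decomp (K := K) w, κ δ ≠ 1 := by
  -- the rational prime `ℓ = N(w ∩ ℤ)` under `w`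
  haveI : w.asIdeal.IsPrime := w.isPrime
  haveI : NeZero w.asIdeal := ⟨by rw [Ideal.zero_eq_bot]; exact w.ne_bot⟩
  obtain ⟨ℓ, hℓ, hℓw⟩ : ∃ ℓ : ℕ, ℓ.Prime ∧ ((ℓ : ℕ) : 𝓞 K) ∈ w.asIdeal :=
    ⟨_, Nat.absNorm_under_prime w.asIdeal, Int.absNorm_under_mem w.asIdeal⟩
  haveI : Fact ℓ.Prime := ⟨hℓ⟩
  have hover : Ideal.span {(ℓ : ℤ)} = w.asIdeal.under ℤ :=
    (EisensteinPrimesMuLambda.asIdeal_mem_primesOver_of_natCast_mem hℓw).2.over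
  have hsplitℓ : ((Ideal.span {(ℓ : ℤ)}).primesOver (𝓞 K)).ncard = 2 := by rw [hover]; exact hsplit
  obtain ⟨he, hf⟩ := ramificationIdx_eq_one_and_inertiaDeg_eq_one_of_ncard_primesOver_eq_two ℓ hK.1 hsplitℓ w hℓw
  have h := ZpExtension.decomp_not_le_kerSubgroup_of_isAnticyclotomic_holds (K := K) (p := p) hK hp2 κ hκ w hpw he hf
  obtain ⟨δ, hδ, hnot⟩ := SetLike.not_le_iff_exists.mp h
  exact ⟨δ, hδ, fun h1 ↦ hnot (ZpExtension.mem_kerSubgroup.mpr h1)⟩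

omit [NumberField K] in
/-- **A Teichmüller character acts trivially through `g` as soon as `g` fixes the `p`-torsion of `(F/𝒪)(θ)`**: if
`θ^{p−1} = 1` and `g • m = m` for every `m ∈ (F/𝒪)(θ)[p]`, then `unitChar θ g = 1` (otherwise `θ(g) − 1 ∈ ℤ_p^×` and `g` fixes
no non-zero point of `(F/𝒪)(θ) ≅ ℚ_p/ℤ_p`, `charModule_eq_zero_of_smul_eq`, contradicting `#(F/𝒪)(θ)[p] = p`). The residual
character of a Teichmüller lift determines it. [cite: SerreLocalFields1979, IV §2 (Teichmüller units)]
[cite: CastellaGrossiLeeSkinner2022, §1.2 ("Via the Teichmüller lift … we shall also view θ as taking values in ℤ_p^×")] -/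
theorem unitChar_eq_one_of_forall_torsion_smul_eq
    (θ : FramedGaloisRep K (padicCoeffIntegers (∅ : Set (PadicAlgCl p))) 1)
    (hθ : ∀ σ : absoluteGaloisGroup K, θ σ ^ (p - 1) = 1) {g : absoluteGaloisGroup K}
    (hg : ∀ m : charModule (∅ : Set (PadicAlgCl p)) θ, p • m = 0 → g • m = m) : unitChar θ g = 1 := by
  by_contra hne
  have hall : ∀ m : (charModule (∅ : Set (PadicAlgCl p)) θ)[(p : ℤ)], m = 0 := fun m ↦ by
    have hm : p • (m : charModule (∅ : Set (PadicAlgCl p)) θ) = 0 := by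
      rw [← natCast_zsmul]; exact m.2
    exact Subtype.ext (CharResidualSelmerCount.charModule_eq_zero_of_smul_eq θ hθ hne (hg _ hm))
  haveI : Subsingleton ((charModule (∅ : Set (PadicAlgCl p)) θ)[(p : ℤ)]) :=
    ⟨fun a b ↦ (hall a).trans (hall b).symm⟩
  have h1 : Nat.card ((charModule (∅ : Set (PadicAlgCl p)) θ)[(p : ℤ)]) = 1 := Nat.card_of_subsingleton 0
  rw [UnrSelmerQuotientTorsionFiniteChar.natCard_torsionBy_charModule θ] at h1
  exact hp.out.one_lt.ne' h1

/-- **A Teichmüller character whose RESIDUAL character is unramified outside `Σ ⊇ S_p` is unramified outside `Σ`, as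
`N_Σ ≤ ker (unitChar θ)`** (the hypothesis `h` of the model `characterRepUnramified Σ θ h` of road (A)). Input shape = CGLS's
binder «the residual character is unramified at every `w ∉ S`, `w ∤ p`»: every `x` in the inertia group `I_w` OF THE CHOSEN
prime above `w` fixes `(F/𝒪)(θ)[p]` pointwise. Proof: `ker (unitChar θ)` is open (`θ^{p−1} = 1`); for a prime `𝔓 ∣ w` of `\bar ℤ_K`
write `𝔓 = τ • 𝔓₀` (`𝔓₀` the chosen prime, `exists_smul_eq_of_mem_primesAbove_holds`), so `I_𝔓 = τ I_{𝔓₀} τ⁻¹`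
(`Ideal.conj_mem_inertia_smul_iff`) with `I_{𝔓₀} = I_w` (`inertia_adicCompletionPrime_eq_map_absInertia`); the previous
lemma kills `I_{𝔓₀}`, and `ker` is normal; conclude by `ramificationSubgroup_le_ker`.
[cite: NeukirchANT1999, Ch. I §9 (9.4)–(9.6) and Ch. II §9 Prop. (9.6)] [cite: NeukirchSchmidtWingberg2008, VIII §3]
[cite: CastellaGrossiLeeSkinner2022, §1.2 Def. 1.2.1 (Σ ⊇ the primes dividing p and the conductor of θ)] -/
theorem ramificationSubgroup_le_ker_unitChar_of_forall_inertia
    (θ : FramedGaloisRep K (padicCoeffIntegers (∅ : Set (PadicAlgCl p))) 1)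
    (hθ : ∀ σ : absoluteGaloisGroup K, θ σ ^ (p - 1) = 1) (Sig : Set (HeightOneSpectrum (𝓞 K)))
    (hunr : ∀ w : HeightOneSpectrum (𝓞 K), w ∉ Sig →
      ∀ x ∈ inertia w, ∀ m : charModule (∅ : Set (PadicAlgCl p)) θ, p • m = 0 → x • m = m) :
    ramificationSubgroup K Sig ≤ (unitChar θ).toMonoidHom.ker := by
  have hp1 : 0 < p - 1 := Nat.sub_pos_of_lt hp.out.one_lt
  have hker := isOpen_ker_unitChar_of_pow_eq_one θ hp1 hθ
  refine ramificationSubgroup_le_ker (unitChar θ).toMonoidHom hker fun w hw 𝔓 h𝔓 σ hσ ↦ ?_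
  obtain ⟨τ, rfl⟩ := HeightOneSpectrum.exists_smul_eq_of_mem_primesAbove_holds
    (adicCompletionPrime_mem_primesAbove K w) h𝔓
  -- `τ⁻¹ σ τ ∈ I_{𝔓₀} = I_w`
  have hσ_eq : σ = τ * (τ⁻¹ * σ * τ) * τ⁻¹ := by group
  have hσ' : τ⁻¹ * σ * τ ∈ (adicCompletionPrime K w).inertia (absoluteGaloisGroup K) := by
    rwa [← Ideal.conj_mem_inertia_smul_iff (adicCompletionPrime K w) τ, ← hσ_eq]
  have hmem : τ⁻¹ * σ * τ ∈ inertia w := by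
    change τ⁻¹ * σ * τ ∈ (absInertia (w.adicCompletion K)).map (absGaloisRestrict K (w.adicCompletion K)).toMonoidHom
    rw [← inertia_adicCompletionPrime_eq_map_absInertia]
    exact hσ'
  have h1 : unitChar θ (τ⁻¹ * σ * τ) = 1 := unitChar_eq_one_of_forall_torsion_smul_eq θ hθ (hunr w hw _ hmem)
  change unitChar θ σ = 1
  rw [hσ_eq, map_mul, map_mul, h1, mul_one, ← map_mul, mul_inv_cancel, map_one]

/-- Bookkeeping (`hsplit` ⇒ the binder of `X11b`-style partner lemmas): if `(p)` has two primes in `𝓞 K` then every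
prime `𝔭 ∋ p` has a partner `v ∋ p`, `𝔭 ≠ v`. [cite: CastellaGrossiLeeSkinner2022, §1 ("p = v v̄ splits")] -/
theorem exists_other_prime_of_ncard_primesOver_eq_two (hsplit : ((Ideal.span {(p : ℤ)}).primesOver (𝓞 K)).ncard = 2)
    (𝔭 : HeightOneSpectrum (𝓞 K)) (h𝔭 : ((p : ℕ) : 𝓞 K) ∈ 𝔭.asIdeal) :
    ∃ v : HeightOneSpectrum (𝓞 K), ((p : ℕ) : 𝓞 K) ∈ v.asIdeal ∧ 𝔭 ≠ v := by
  -- adapted from `Summit.BirchSwinnertonDyer.Rank1Residual.X11b.exists_other_prime`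
  obtain ⟨P, Q, hPQ, hset⟩ := Set.ncard_eq_two.mp hsplit
  have h𝔭mem := EisensteinPrimesMuLambda.asIdeal_mem_primesOver_of_natCast_mem (p := p) h𝔭
  rw [hset] at h𝔭mem
  have key : ∀ R ∈ ({P, Q} : Set (Ideal (𝓞 K))), R ≠ 𝔭.asIdeal →
      ∃ v : HeightOneSpectrum (𝓞 K), ((p : ℕ) : 𝓞 K) ∈ v.asIdeal ∧ 𝔭 ≠ v := by
    intro R hR hne
    have hR' : R ∈ (Ideal.span {(p : ℤ)}).primesOver (𝓞 K) := by rw [hset]; exact hR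
    obtain ⟨hRprime, hRover⟩ := hR'
    have hpR : ((p : ℕ) : 𝓞 K) ∈ R := by
      have : (algebraMap ℤ (𝓞 K)) (p : ℤ) ∈ R := by
        rw [← Ideal.mem_comap, ← Ideal.under_def, ← hRover.over]
        exact Ideal.subset_span rfl
      rwa [map_natCast] at this
    have hRne : R ≠ ⊥ := by
      intro hb
      rw [hb, Ideal.mem_bot] at hpR
      exact (Nat.cast_ne_zero.mpr hp.out.ne_zero) hpR
    exact ⟨⟨R, hRprime, hRne⟩, hpR, fun h ↦ hne (by rw [h])⟩
  rcases h𝔭mem with h | h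
  · exact key Q (by simp) (by rw [h]; exact hPQ.symm)
  · exact key P (by simp) (by rw [h]; exact hPQ)

omit hp in
/-- Bookkeeping: equal subgroups have quotients of equal `ℤ_p`-corank (transport of the conclusion along g8's bridge
`H¹_{𝓕_Gr^{S₀}} = H¹_{𝓕_nr^{S₀}}`). [cite: CastellaGrossiLeeSkinner2022, proof of Thm. 1.2.2 ("the same as the one defined by the unramified local conditions")] -/
theorem zpCorank_quotient_congr {G : Type*} [AddCommGroup G] {A A' B B' : AddSubgroup G} (h : A = B) (h' : A' = B') :
    zpCorank (↥A ⧸ A'.addSubgroupOf A) p = zpCorank (↥B ⧸ B'.addSubgroupOf B) p := by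
  subst h h'
  rfl

/-! ## §2 [RH] for the model at a CGLS character: `corank_Λ S_{𝓛_v}(K, 𝐃₁(θ)) = 0` from Prop. 1.2.5's module clause -/

/-- **The primitive UNRAMIFIED dual `𝔛_θ = H¹_{𝓕_nr}(K_∞, (F/𝒪)(θ))^∨` (any datum) is finitely generated `Λ`-torsion at a CGLS
character, GRANTED CGLS Prop. 1.2.5's module clause BY NAME** (`p` odd, `K` imaginary quadratic, `(p)` split, `κ` anticyclotomic
with topological generator `γ`, `𝔭 = v̄ ∋ p`, `θ` Teichmüller-valued, residual character unramified outside `S ∪ {w ∣ p}` with `S`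
prime-to-`p` over split rational primes, `θ|_{G_v̄} ≠ 𝟙, ω`): the fact gives `𝔛_θ^S` (STRICT, `S`-imprimitive) f.g. torsion with
`μ = 0`; g8's strict λ-shift (`GrSelmerImprimitiveLambdaShift.lambdaInvariant_eq_add_zpCorank_of_muInvariant_eq_zero`, kernel)
passes to the primitive strict dual; g8's UNCONDITIONAL bridge `grSelmer_charModule_eq_unrSelmer` (`θ|_{G_v̄} ≠ 𝟙`) with the
transfer `prop_datumDualData_of_forall_grDualData` passes to the unramified dual. (In print: Thm. 1.2.2 = Rubin 1991 + Hida 2010,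
«the Selmer group `H¹_{F_Gr}(K, M_θ)` is the same as the one defined by the unramified local conditions».)
[cite: CastellaGrossiLeeSkinner2022, Thm. 1.2.2 and Prop. 1.2.5 (arXiv:2008.02571 Thm. 11, Prop. 14)]
[cite: KellerYin2024, Thm. 1.2.2, Rem. 1.2.3 (i) (arXiv:2402.12781v2)] -/
theorem unrDual_moduleFinite_isTorsion_of_fact (hprop125 : prop125_characterGrSelmerDual_torsion_muZero_dim)
    (hK : IsImaginaryQuadratic K) (hp2 : p ≠ 2) (hsplit : ((Ideal.span {(p : ℤ)}).primesOver (𝓞 K)).ncard = 2)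
    (κ : ZpExtension K p) (hκ : κ.IsAnticyclotomic) {γ : absoluteGaloisGroup K} (hγ : κ.IsTopGenerator γ)
    (𝔭 : HeightOneSpectrum (𝓞 K)) (h𝔭 : ((p : ℕ) : 𝓞 K) ∈ 𝔭.asIdeal)
    (θ : FramedGaloisRep K (padicCoeffIntegers (∅ : Set (PadicAlgCl p))) 1)
    (hθ : ∀ σ : absoluteGaloisGroup K, θ σ ^ (p - 1) = 1)
    (S : Finset (HeightOneSpectrum (𝓞 K)))
    (hSmem : ∀ v ∈ S, ((p : ℕ) : 𝓞 K) ∉ v.asIdeal ∧ ((v.asIdeal.under ℤ).primesOver (𝓞 K)).ncard = 2)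
    (hunr : ∀ v : HeightOneSpectrum (𝓞 K), v ∉ S → ((p : ℕ) : 𝓞 K) ∉ v.asIdeal →
      ∀ x ∈ inertia v, ∀ m : charModule (∅ : Set (PadicAlgCl p)) θ, p • m = 0 → x • m = m)
    (hne1 : ¬ ∀ g ∈ decomp 𝔭, ∀ m : charModule (∅ : Set (PadicAlgCl p)) θ, p • m = 0 → g • m = m)
    (hneω : ¬ ∀ g ∈ decomp 𝔭, ∀ m : charModule (∅ : Set (PadicAlgCl p)) θ, p • m = 0 →
      g • m = ((modNCyclotomicCharacter K p g : (ZMod p)ˣ) : ZMod p).val • m)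
    (D : DatumDualData κ γ (charModule (∅ : Set (PadicAlgCl p)) θ)
      (Castella2018.AcSelmer.bdpData (charModule (∅ : Set (PadicAlgCl p)) θ) p 𝔭) (∅ : Set (HeightOneSpectrum (𝓞 K)))) :
    Module.Finite (IwasawaAlgebra p) D.X ∧ Module.IsTorsion (IwasawaAlgebra p) D.X := by
  have hSmem' : ∀ v ∈ (↑S : Set (HeightOneSpectrum (𝓞 K))), ((p : ℕ) : 𝓞 K) ∉ v.asIdeal ∧
      ((v.asIdeal.under ℤ).primesOver (𝓞 K)).ncard = 2 := fun v hv ↦ hSmem v (Finset.mem_coe.mp hv)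
  have hunr' : ∀ v : HeightOneSpectrum (𝓞 K), v ∉ (↑S : Set (HeightOneSpectrum (𝓞 K))) → ((p : ℕ) : 𝓞 K) ∉ v.asIdeal →
      ∀ x ∈ inertia v, ∀ m : charModule (∅ : Set (PadicAlgCl p)) θ, p • m = 0 → x • m = m :=
    fun v hv ↦ hunr v (fun h ↦ hv (Finset.mem_coe.mpr h))
  -- the `S`-imprimitive STRICT dual is f.g. torsion with `μ = 0` (CGLS Prop. 1.2.5, by name)
  obtain ⟨DS⟩ := nonempty_grDualData_char (∅ : Set (PadicAlgCl p)) θ κ 𝔭 (↑S : Set (HeightOneSpectrum (𝓞 K))) hγ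
  obtain ⟨hfg, hT, hμ, -⟩ := hprop125 K p hK hp2 hsplit κ hκ γ hγ 𝔭 h𝔭 θ hθ (↑S : Set (HeightOneSpectrum (𝓞 K)))
    S.finite_toSet hSmem' hunr' hne1 hneω DS
  haveI := hfg
  -- every primitive STRICT dual is f.g. torsion (strict λ-shift, kernel)
  have hP : ∀ G : GrDualData κ (charModule (∅ : Set (PadicAlgCl p)) θ) 𝔭 (∅ : Set (HeightOneSpectrum (𝓞 K))) γ,
      Module.Finite (IwasawaAlgebra p) G.X ∧ Module.IsTorsion (IwasawaAlgebra p) G.X := fun G ↦ by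
    obtain ⟨hfg0, hT0, -, -, -⟩ :=
      GrSelmerImprimitiveLambdaShift.lambdaInvariant_eq_add_zpCorank_of_muInvariant_eq_zero κ 𝔭
        (exists_pow_smul_cofree_eq_zero (∅ : Set (PadicAlgCl p)) θ) (isOpen_stabilizer_cofree (∅ : Set (PadicAlgCl p)) θ) hγ
        (Set.empty_subset (↑S : Set (HeightOneSpectrum (𝓞 K)))) DS hT hμ G
    exact ⟨hfg0, hT0⟩
  -- the bridge `H¹_{𝓕_Gr} = H¹_{𝓕_nr}` at `∅` (unconditional for `θ|_{G_v̄} ≠ 𝟙`) and the transfer of dual data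
  have hbridge := StrictEqUnramifiedCentral.grSelmer_charModule_eq_unrSelmer κ 𝔭 (∅ : Set (HeightOneSpectrum (𝓞 K))) θ hθ hne1
  exact StrictEqUnramifiedCentral.prop_datumDualData_of_forall_grDualData κ 𝔭 (∅ : Set (HeightOneSpectrum (𝓞 K))) hbridge
    (fun X _ _ ↦ Module.Finite (IwasawaAlgebra p) X ∧ Module.IsTorsion (IwasawaAlgebra p) X) hP D

/-! ## §3 The discharge -/

/-- **CGLS 2022 Prop. 1.2.5's corank clause — `CastellaGrossiLeeSkinner2022.prop125_characterGrSelmerDual_corank_ge` VERBATIM — FROM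
Greenberg 2016 Prop. 2.6.3, Greenberg 2006 Props. 4.1 / 4.2 / §5 A / 3.2 and CGLS Prop. 1.2.5's module clause, BY NAME.** For
`p` odd, `K` imaginary quadratic with `(p)` split, `κ` anticyclotomic, `𝔭 = v̄ ∋ p`, `θ : Γ_K → GL₁(𝒪)` Teichmüller-valued with residual
character unramified outside `S ∪ {w ∣ p}` (`S` finite, prime to `p`, over rational primes split in `K`) and `θ|_{G_v̄} ≠ 𝟙, ω`:
`Σ_{w∈S} λ(𝒫_w(θ)) ≤ corank_{ℤ_p}(H¹_{𝓕_Gr^S}(K_∞, (F/𝒪)(θ)) / H¹_{𝓕_Gr}(K_∞, (F/𝒪)(θ)))`. Proof = CGLS's (eq:sur1)–(eq:sur2) IN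
THE KERNEL: the one-variable twist deformation `𝐃₁(θ) = ℚ_p/ℤ_p(θ) ⊗ Λ^*(κ⁻¹)` over `K_Σ/K`, `Σ = {v, v̄} ∪ S` (`N_Σ ≤ ker θ`, §1),
satisfies `SUR(𝐃₁(θ), 𝓛_v)` by Greenberg 2016 Prop. 2.6.3 (`LEO` + `CRK`; `corank_Λ S_{𝓛_v} = 0` from §2; the `σ`-supply at
`v, v̄` by class field theory and at `S` by Brink), whence by Shapiro's lemma the `K_∞`-side global-to-local map onto
`∏_{w∈S} ∏_{η∣w} H¹(K_{∞,η}, (F/𝒪)(θ))` is ONTO with kernel `H¹_{𝓕_nr}` (road (A), x1 LEAD g2: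
`exists_mem_unrSelmer_forall_resOfLe_conjH1_eq`), the coranks add up to `≥ Σ_{w∈S} [Γ:Γ_w]·𝟙[θ(Frob_w) ≡ Nw]` (Lemma 1.1.1; the
x1 width seats' `UnrSelmerLocSurjAdapter`), and g8's bridge `H¹_{𝓕_Gr^{S₀}} = H¹_{𝓕_nr^{S₀}}` (`θ|_{G_v̄} ≠ 𝟙`) moves the inequality
to the strict groups. Discharges the named fact p657936 (debt −1); its consumers p658583 / p659748 / p661876 / p659330 /
p662145 become theorems modulo PUBLISHED facts already among their other hypotheses.
[cite: CastellaGrossiLeeSkinner2022, §1.2 Prop. 1.2.5 `propchar` and proof (eq:sur1)–(eq:sur2), Lemma 1.1.1, Thm. 1.2.2 (arXiv:2008.02571 Prop. 14, Lemma 9, Thm. 11; Invent. Math. 227 (2022) 517–580)]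
[cite: PollackWeston2011, App. A Prop. A.2] [cite: Greenberg2016Selmer, Prop. 2.6.3 (§2.6 p. 10)]
[cite: Greenberg2006, Props. 3.2, 4.1, 4.2, §5 A] [cite: Brink2007, Thm. 2 and Cor. 1]
[cite: GreenbergVatsal2000, §2 Cor. (2.3), Prop. (2.4) (pp. 20–23)] [cite: KellerYin2024, Prop. 1.2.5, Rem. 1.2.3 (arXiv:2402.12781v2 TeX L780–800)] -/
theorem prop125_characterGrSelmerDual_corank_ge_of_facts (h263 : prop263_sur_of_crk)
    (h41 : prop41_globalEulerPoincareCorank) (h42 : prop42_localEulerPoincareCorank)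
    (h5A : sec5A_localH2_subsingleton_of_LOC1) (h32 : prop32_cohomology_isCofinitelyGenerated)
    (hprop125 : prop125_characterGrSelmerDual_torsion_muZero_dim) :
    prop125_characterGrSelmerDual_corank_ge := by
  intro K _ _ p _ hK hp2 hsplit κ hκ 𝔭 h𝔭 θ hθ S hSmem hunr hne1 hneω
  have hp : 2 < p := lt_of_le_of_ne (Fact.out : p.Prime).two_le (Ne.symm hp2)
  obtain ⟨γ, hγ⟩ : ∃ γ : absoluteGaloisGroup K, κ.IsTopGenerator γ := κ.surjective (Multiplicative.ofAdd 1)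
  -- the partner prime `v ∣ p`, `v ≠ 𝔭 = v̄`
  obtain ⟨v, hv, hne⟩ := exists_other_prime_of_ncard_primesOver_eq_two (p := p) hsplit 𝔭 h𝔭
  have hSp : ∀ w : HeightOneSpectrum (𝓞 K), ((p : ℕ) : 𝓞 K) ∈ w.asIdeal → w = v ∨ w = 𝔭 :=
    fun w hw ↦ GreenbergFullAtSelmer.eq_or_eq_of_natCast_mem_of_ne hK.1 hv h𝔭 hne hw
  have hSfp : ∀ w ∈ S, ((p : ℕ) : 𝓞 K) ∉ w.asIdeal := fun w hw ↦ (hSmem w hw).1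
  -- every `w ∈ S` is finitely decomposed in `K_∞` (Brink), with `κ(D_w) = p^{a_w} ℤ_p` exactly
  have hdec : ∀ w ∈ S, ∃ δ ∈ decomp (K := K) w, κ δ ≠ 1 := fun w hw ↦
    exists_mem_decomp_apply_ne_one_of_ncard_primesOver_under hK hp2 κ hκ w (hSmem w hw).1 (hSmem w hw).2
  have hdec' : ∀ w ∈ S, ¬ decomp (K := K) w ≤ κ.kerSubgroup := fun w hw hle ↦ by
    obtain ⟨δ, hδ, hne1⟩ := hdec w hw
    exact hne1 (ZpExtension.mem_kerSubgroup.mp (hle hδ))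
  have hexp : ∀ w : HeightOneSpectrum (𝓞 K), ∃ a : ℕ, w ∈ S →
      (∃ δ ∈ decomp (K := K) w, (κ δ).toAdd = (p : ℤ_[p]) ^ a) ∧
        ∀ δ ∈ decomp (K := K) w, (p : ℤ_[p]) ^ a ∣ (κ δ).toAdd := by
    intro w
    by_cases hw : w ∈ S
    · obtain ⟨c, ⟨d₀, hd₀⟩, -, hdvd⟩ :=
        UniversalToricDescentSigmaLocalStabilizer.exists_pow_and_forall_dvd_of_not_le κ w (hdec' w hw)
      exact ⟨c, fun _ ↦ ⟨⟨d₀, d₀.2, hd₀⟩, fun δ hδ ↦ hdvd ⟨δ, hδ⟩⟩⟩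
    · exact ⟨0, fun h ↦ (hw h).elim⟩
  choose a ha using hexp
  have hd₀ : ∀ w ∈ S, ∃ δ ∈ decomp (K := K) w, (κ δ).toAdd = (p : ℤ_[p]) ^ a w :=
    fun w hw ↦ (ha w hw).1
  have hdiv : ∀ w ∈ S, ∀ δ ∈ decomp (K := K) w, (p : ℤ_[p]) ^ a w ∣ (κ δ).toAdd :=
    fun w hw ↦ (ha w hw).2
  -- the representatives `γ^i` of the places above `w`: `κ(γ^i) = i`
  have hσrep : ∀ w ∈ S, ∀ i : ℕ, i < p ^ a w → (κ ((fun (_ : HeightOneSpectrum (𝓞 K)) (i : ℕ) ↦ γ ^ i) w i)).toAdd =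
      (i : ℤ_[p]) := fun w _ i _ ↦ by
    change (κ (γ ^ i)).toAdd = (i : ℤ_[p])
    rw [map_pow, show κ γ = Multiplicative.ofAdd 1 from hγ, ← ofAdd_nsmul, toAdd_ofAdd, nsmul_one]
  -- `Σ = {v, v̄} ∪ S`; `θ` is unramified outside `Σ`
  have hS : ∀ w : HeightOneSpectrum (𝓞 K), ((p : ℕ) : 𝓞 K) ∈ w.asIdeal →
      w ∈ (↑(insert v (insert 𝔭 S)) : Set (HeightOneSpectrum (𝓞 K))) :=
    mem_insert_insert_of_natCast_mem hK hv h𝔭 hne S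
  have hSfS : ∀ w ∈ S, w ∈ (↑(insert v (insert 𝔭 S)) : Set (HeightOneSpectrum (𝓞 K))) := fun w hw ↦ by
    rw [Finset.coe_insert, Finset.coe_insert]
    exact Or.inr (Or.inr (Finset.mem_coe.mpr hw))
  have h : ramificationSubgroup K (↑(insert v (insert 𝔭 S)) : Set (HeightOneSpectrum (𝓞 K))) ≤
      (unitChar θ).toMonoidHom.ker :=
    ramificationSubgroup_le_ker_unitChar_of_forall_inertia θ hθ _ fun w hw ↦
      hunr w (fun hwS ↦ hw (hSfS w hwS)) (fun hwp ↦ hw (hS w hwp))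
  -- the `σ`-supply at every place of `Σ`
  have hsup : ∀ w ∈ (↑(insert v (insert 𝔭 S)) : Set (HeightOneSpectrum (𝓞 K))),
      ∃ σ : absoluteGaloisGroup (Place.Completion (Sum.inr w : Place K)), κ (absGaloisRestrict K _ σ) ≠ 1 := by
    intro w hw
    rw [Finset.coe_insert, Finset.coe_insert] at hw
    rcases hw with rfl | rfl | hw
    · exact exists_local_apply_ne_one_of_natCast_mem hK κ hv
    · exact exists_local_apply_ne_one_of_natCast_mem hK κ h𝔭
    · exact exists_local_apply_ne_one_of_exists_mem_decomp κ (hdec w (Finset.mem_coe.mp hw))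
  -- the canonical (discrete) topological instances of the model
  letI tΛ : TopologicalSpace (PowerSeries ℤ_[p]) := ⊥
  haveI : DiscreteTopology (PowerSeries ℤ_[p]) := ⟨rfl⟩
  haveI : IsTopologicalRing (PowerSeries ℤ_[p]) := inferInstance
  haveI hAdisc : DiscreteTopology (QpModZp p) := QpModZp.discreteTopology p
  haveI : IsTopologicalAddGroup (BigRepModule ℤ_[p] p (QpModZp p)) := inferInstance
  haveI : ContinuousSMul (PowerSeries ℤ_[p]) (BigRepModule ℤ_[p] p (QpModZp p)) := inferInstance
  -- the model `ρ_θ` on `ℚ_p/ℤ_p`, `ψ = (charModuleEquiv θ)⁻¹`, the Shapiro descent `F`, and [RH] (§2)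
  have hψ := charModuleEquiv_symm_galois (↑(insert v (insert 𝔭 S)) : Set (HeightOneSpectrum (𝓞 K))) θ h
  obtain ⟨F, hF⟩ := exists_shapiroDescent _ hS κ (characterRepUnramified _ θ h) (charModuleEquiv θ).symm hψ
  obtain ⟨D⟩ := nonempty_unrDualData_char (∅ : Set (PadicAlgCl p)) θ κ 𝔭 (∅ : Set (HeightOneSpectrum (𝓞 K))) hγ
  obtain ⟨hDfin, hDtor⟩ := unrDual_moduleFinite_isTorsion_of_fact hprop125 hK hp2 hsplit κ hκ hγ 𝔭 h𝔭 θ hθ S hSmem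
    hunr hne1 hneω D
  obtain ⟨hSel, hSelfg⟩ := hasCorank_fullAtSelmer_zero_of_datumDualData _ hS κ (characterRepUnramified _ θ h)
    (charModuleEquiv θ).symm hψ (QpModZp.exists_pow_nsmul_eq_zero (p := p))
    (exists_pow_smul_cofree_eq_zero (∅ : Set (PadicAlgCl p)) θ) (isOpen_stabilizer_cofree (∅ : Set (PadicAlgCl p)) θ)
    hγ hv hne hSp D hDfin hDtor
  -- the `K_∞`-side global-to-local surjectivity (road (A), file 8)
  have h8 : ∀ y : ∀ w : HeightOneSpectrum (𝓞 K), ℕ →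
      subgroupH1 (κ.kerSubgroup ⊓ decomp (K := K) w) (charModule (∅ : Set (PadicAlgCl p)) θ),
      ∃ u ∈ unrSelmer κ (charModule (∅ : Set (PadicAlgCl p)) θ) 𝔭 (↑S : Set (HeightOneSpectrum (𝓞 K))),
        ∀ w ∈ S, ∀ i : ℕ, i < p ^ a w →
          resOfLe (charModule (∅ : Set (PadicAlgCl p)) θ)
            (inf_le_left : κ.kerSubgroup ⊓ decomp (K := K) w ≤ κ.kerSubgroup)
            (conjH1 κ.kerSubgroup (charModule (∅ : Set (PadicAlgCl p)) θ) (γ ^ i) u) = y w i := fun y ↦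
    exists_mem_unrSelmer_forall_resOfLe_conjH1_eq _ hS κ (characterRepUnramified _ θ h)
      (charModuleEquiv θ).symm hψ h263 h41 h42 h5A h32 (Finset.finite_toSet _) hK
      (LinearEquiv.refl ℤ_[p] (QpModZp p)) (characterRepUnramified_hscalar _ θ h) hsup
      hne hv h𝔭 hSp hSel hSelfg (fun b ↦ QpModZp.exists_pow_nsmul_eq_zero b) hF S hSfS hSfp a hdiv hd₀
      (fun _ i ↦ γ ^ i) hσrep y
  -- corank bookkeeping: the `𝓕_nr` inequality
  have hunrineq := UnrSelmerLocSurjAdapter.sum_charLocalLambda_le_zpCorank_unrSelmer_quotient_of_forall_exists κ θ 𝔭 S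
    hθ hγ hSfp hdec a hdiv hd₀ (fun _ i ↦ γ ^ i) hσrep h8
  -- g8's bridge at `S` and at `∅`: the `𝓕_Gr` inequality
  rw [zpCorank_quotient_congr
    (StrictEqUnramifiedCentral.grSelmer_charModule_eq_unrSelmer κ 𝔭 (↑S : Set (HeightOneSpectrum (𝓞 K))) θ hθ hne1)
    (StrictEqUnramifiedCentral.grSelmer_charModule_eq_unrSelmer κ 𝔭 (∅ : Set (HeightOneSpectrum (𝓞 K))) θ hθ hne1)]
  exact hunrineq

end Summit.BirchSwinnertonDyer.BirchSwinnertonDyer.Theorems.CharGrSelmerCorankGeOfFacts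

end
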